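import Summits.ValiantsHypothesis.ValiantsHypothesis.Theorems.SymPencilPerFourHyperplanePencilOrders

/-!
# Route `SymPencil` — the one-row pencil core of hyperplane flow rigidity, II-A: tools for the
# rank-one lemma (tool file, `--supports` stmt-ValiantsHypothesis-5674; nothing here bears on `VP ≠ VNP`)

Stub S1c of cell `(12,4,2)` (memo `Cruxes/SdcSuperquadratic/CELL-TWELVE-FOUR.md` §5) is reduced in
`SymPencilPerFourHyperplanePencilOrders.exists_kernel_hyperplane_of_X₂_eq_zero` to two statements;
the second is the RANK-ONE LEMMA: a linear map `A` of `K⁴` with `A² = 0` which is self-adjoint for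
every form `T(·,·,c) = per [𝟙; ·; ·; c]`, `c ∈ ker μ` (`μ ≠ 0`), has rank `≤ 1`.  Since
`T(Aa, Ab, c) = T(a, A²b, c) = 0`, the image of `A` is ISOTROPIC for the net `{T(·,·,c) : c ∈ ker μ}`;
this file collects the tools that turn isotropy into nodes of the Cayley cubic `e₃ = 0`:

* `per_self_single₀…₃`: `T(v, v, e_p) = 2 e₂(v without p)`;
* `node_of_per_self_eq_zero`: `T(v,v,e_p) = 0` for all `p` forces `v` to have at most one non-zero
  coordinate (the four nodes `e_i` of the Cayley cubic);
* `exists_coeff_of_vanish`: a coefficient vector orthogonal to `ker μ` is a multiple of `μ`;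
* `vanish_or_vanish_of_mul_eq_zero`: a product of two linear forms vanishing on the span of `w, w'`
  has a factor vanishing there;
* `false_of_isotropic_pair_const` (Case B of the rank-one lemma): if all `μ(e_p)` are equal
  (`μ ≠ 0`), two linearly independent vectors `w, w'` cannot span a `T(·,·,ker μ)`-isotropic plane;
* `false_of_single₀_single₁_mem_range` (the per₂ kill): a self-adjoint square-zero `A` cannot have
  both `e₀` and `e₁` in its image.

Elementary. [folklore]
-/

-- single-conjunct layout: Sub = Summit, duplicated namespace component intended
set_option linter.dupNamespace false

namespace Summit.ValiantsHypothesis.ValiantsHypothesis.Theorems.SymPencilPerFourHyperplanePencilRankOneA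

open Matrix
open Summit.ValiantsHypothesis.ValiantsHypothesis.Theorems.SymPencilPerFourInnerRankRows
  (permanent_of_rows)
open Summit.ValiantsHypothesis.ValiantsHypothesis.Theorems.SymPencilPerFourBoxInjective
  (apply_eq_dotProduct exists_smul_of_dotProduct)
open Summit.ValiantsHypothesis.ValiantsHypothesis.Theorems.SymPencilPerFourHyperplanePencilOrders
  (per_swap₁₂ per_swap₂₃)

variable {K : Type*} [Field K]

/-! ### Explicit values -/

/-- `T(v, v, e₀) = 2 e₂(v₁, v₂, v₃)`. [folklore] -/
theorem per_self_single₀ (v : Fin 4 → K) :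
    (Matrix.of ![(fun _ => (1 : K)), v, v, Pi.single 0 1]).permanent =
      2 * (v 1 * v 2 + v 1 * v 3 + v 2 * v 3) := by
  simp [permanent_of_rows]; ring

/-- `T(v, v, e₁) = 2 e₂(v₀, v₂, v₃)`. [folklore] -/
theorem per_self_single₁ (v : Fin 4 → K) :
    (Matrix.of ![(fun _ => (1 : K)), v, v, Pi.single 1 1]).permanent =
      2 * (v 0 * v 2 + v 0 * v 3 + v 2 * v 3) := by
  simp [permanent_of_rows]; ring

/-- `T(v, v, e₂) = 2 e₂(v₀, v₁, v₃)`. [folklore] -/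
theorem per_self_single₂ (v : Fin 4 → K) :
    (Matrix.of ![(fun _ => (1 : K)), v, v, Pi.single 2 1]).permanent =
      2 * (v 0 * v 1 + v 0 * v 3 + v 1 * v 3) := by
  simp [permanent_of_rows]; ring

/-- `T(v, v, e₃) = 2 e₂(v₀, v₁, v₂)`. [folklore] -/
theorem per_self_single₃ (v : Fin 4 → K) :
    (Matrix.of ![(fun _ => (1 : K)), v, v, Pi.single 3 1]).permanent =
      2 * (v 0 * v 1 + v 0 * v 2 + v 1 * v 2) := by
  simp [permanent_of_rows]; ring

/-- Linearity of `T(x, y, c)` in the last row, as a dot product with the coefficient vector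
`p ↦ T(x, y, e_p)`. [folklore] -/
theorem per_last_eq_dotProduct (x y c : Fin 4 → K) :
    (Matrix.of ![(fun _ => (1 : K)), x, y, c]).permanent =
      (fun p => (Matrix.of ![(fun _ => (1 : K)), x, y, Pi.single p 1]).permanent) ⬝ᵥ c := by
  simp [permanent_of_rows, dotProduct, Fin.sum_univ_four, Pi.single_apply]; ring

/-- **A coefficient vector orthogonal to `ker μ` is a multiple of `μ`.** [folklore] -/
theorem exists_coeff_of_vanish (μ : (Fin 4 → K) →ₗ[K] K) (ψ : Fin 4 → K)
    (h : ∀ c : Fin 4 → K, μ c = 0 → ψ ⬝ᵥ c = 0) :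
    ∃ t : K, ∀ p, ψ p = t * μ (Pi.single p 1) := by
  obtain ⟨t, ht⟩ := exists_smul_of_dotProduct (fun k => μ (Pi.single k 1)) ψ fun a ha =>
    h a (by rw [apply_eq_dotProduct]; exact ha)
  exact ⟨t, fun p => by rw [ht]; simp⟩

variable [CharZero K]

/-! ### Nodes of the Cayley cubic -/

/-- **The four nodes**: if `T(v, v, e_p) = 0` for `p = 0, 1, 2, 3` then `v` has at most one non-zero
coordinate. [folklore] -/
theorem node_of_per_self_eq_zero (v : Fin 4 → K)
    (h0 : (Matrix.of ![(fun _ => (1 : K)), v, v, Pi.single 0 1]).permanent = 0)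
    (h1 : (Matrix.of ![(fun _ => (1 : K)), v, v, Pi.single 1 1]).permanent = 0)
    (h2 : (Matrix.of ![(fun _ => (1 : K)), v, v, Pi.single 2 1]).permanent = 0)
    (h3 : (Matrix.of ![(fun _ => (1 : K)), v, v, Pi.single 3 1]).permanent = 0) :
    (v 1 = 0 ∧ v 2 = 0 ∧ v 3 = 0) ∨ (v 0 = 0 ∧ v 2 = 0 ∧ v 3 = 0) ∨
      (v 0 = 0 ∧ v 1 = 0 ∧ v 3 = 0) ∨ (v 0 = 0 ∧ v 1 = 0 ∧ v 2 = 0) := by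
  rw [per_self_single₀] at h0
  rw [per_self_single₁] at h1
  rw [per_self_single₂] at h2
  rw [per_self_single₃] at h3
  have E0 : v 1 * v 2 + v 1 * v 3 + v 2 * v 3 = 0 := by linear_combination h0 / 2
  have E1 : v 0 * v 2 + v 0 * v 3 + v 2 * v 3 = 0 := by linear_combination h1 / 2
  have E2 : v 0 * v 1 + v 0 * v 3 + v 1 * v 3 = 0 := by linear_combination h2 / 2
  have E3 : v 0 * v 1 + v 0 * v 2 + v 1 * v 2 = 0 := by linear_combination h3 / 2
  have hA : (v 1 - v 0) * (v 2 + v 3) = 0 := by linear_combination E0 - E1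
  have hB : (v 3 - v 2) * (v 0 + v 1) = 0 := by linear_combination E2 - E3
  have hC : (v 2 - v 0) * (v 1 + v 3) = 0 := by linear_combination E0 - E2
  rcases mul_eq_zero.1 hA with h01 | h23
  · -- `v 0 = v 1`
    have hv1 : v 1 = v 0 := by linear_combination h01
    by_cases hv0 : v 0 = 0
    · have hv1' : v 1 = 0 := by rw [hv1, hv0]
      have h23' : v 2 * v 3 = 0 := by
        have := E0; rw [hv1', zero_mul, zero_mul, zero_add, zero_add] at this; exact this
      rcases mul_eq_zero.1 h23' with h2' | h3'
      · exact Or.inr (Or.inr (Or.inr ⟨hv0, hv1', h2'⟩))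
      · exact Or.inr (Or.inr (Or.inl ⟨hv0, hv1', h3'⟩))
    · exfalso
      have hv3 : v 3 = v 2 := by
        rcases mul_eq_zero.1 hB with h | h
        · linear_combination h
        · exfalso; apply hv0; linear_combination (h - hv1) / 2
      have hq : v 0 * (v 0 + 2 * v 2) = 0 := by
        have := E3; rw [hv1] at this; linear_combination this
      have hq' : v 0 + 2 * v 2 = 0 := (mul_eq_zero.1 hq).resolve_left hv0
      rcases mul_eq_zero.1 hC with h | h
      · apply hv0; linear_combination (hq' - 2 * h) / 3
      · apply hv0; linear_combination 2 * h - 2 * hv1 - 2 * hv3 - hq'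
  · -- `v 2 + v 3 = 0`, `v 0 ≠ v 1` allowed
    by_cases h01 : v 1 - v 0 = 0
    · -- also `v 0 = v 1`: same as above branch, redo quickly
      have hv1 : v 1 = v 0 := by linear_combination h01
      by_cases hv0 : v 0 = 0
      · have hv1' : v 1 = 0 := by rw [hv1, hv0]
        have h23' : v 2 * v 3 = 0 := by
          have := E0; rw [hv1', zero_mul, zero_mul, zero_add, zero_add] at this; exact this
        rcases mul_eq_zero.1 h23' with h2' | h3'
        · exact Or.inr (Or.inr (Or.inr ⟨hv0, hv1', h2'⟩))
        · exact Or.inr (Or.inr (Or.inl ⟨hv0, hv1', h3'⟩))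
      · exfalso
        have hv3 : v 3 = -v 2 := by linear_combination h23
        have hq : v 0 * v 0 = 0 := by
          linear_combination (E2 + E3) / 2 - v 0 * h01 - (v 0 + v 1) / 2 * h23
        exact hv0 (mul_self_eq_zero.1 hq)
    · by_cases hv2 : v 2 = 0
      · have hv3 : v 3 = 0 := by linear_combination h23 - hv2
        have h01' : v 0 * v 1 = 0 := by
          have := E2; rw [hv3, mul_zero, mul_zero, add_zero, add_zero] at this; exact this
        rcases mul_eq_zero.1 h01' with h0' | h1'
        · exact Or.inr (Or.inl ⟨h0', hv2, hv3⟩)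
        · exact Or.inl ⟨h1', hv2, hv3⟩
      · exfalso
        have hs : v 0 + v 1 = 0 := by
          rcases mul_eq_zero.1 hB with h | h
          · exfalso; apply hv2; linear_combination (h23 - h) / 2
          · exact h
        have hq : v 0 * v 0 = 0 := by
          linear_combination -E3 + v 0 * hs + v 2 * hs
        have hv0 : v 0 = 0 := mul_self_eq_zero.1 hq
        apply h01; linear_combination hs - 2 * hv0

/-! ### Products of linear forms on a plane -/

omit [CharZero K] in
/-- **A product of two linear forms vanishing on `span(w, w')` has a factor vanishing there.**
[folklore] -/
theorem vanish_or_vanish_of_mul_eq_zero (f g : (Fin 4 → K) →ₗ[K] K) (w w' : Fin 4 → K)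
    (h : ∀ s t : K, f (s • w + t • w') * g (s • w + t • w') = 0) :
    (f w = 0 ∧ f w' = 0) ∨ (g w = 0 ∧ g w' = 0) := by
  have hw : f w * g w = 0 := by simpa using h 1 0
  have hw' : f w' * g w' = 0 := by simpa using h 0 1
  have h11 : (f w + f w') * (g w + g w') = 0 := by simpa using h 1 1
  have h12 : (f w + 2 * f w') * (g w + 2 * g w') = 0 := by
    have := h 1 2; simp only [one_smul, map_add, map_smul, smul_eq_mul] at this
    linear_combination this
  by_cases hf : f w = 0
  · by_cases hf' : f w' = 0
    · exact Or.inl ⟨hf, hf'⟩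
    · right
      have hg' : g w' = 0 := (mul_eq_zero.1 hw').resolve_left hf'
      refine ⟨?_, hg'⟩
      have : f w' * g w = 0 := by
        rw [hf, hg'] at h11; simpa using h11
      exact (mul_eq_zero.1 this).resolve_left hf'
  · right
    have hg : g w = 0 := (mul_eq_zero.1 hw).resolve_left hf
    refine ⟨hg, ?_⟩
    by_contra hg'
    have hf' : f w' = 0 := (mul_eq_zero.1 hw').resolve_right hg'
    rw [hg, hf', zero_add] at h11 h12
    rw [add_zero] at h11
    rw [mul_zero, add_zero] at h12
    have := (mul_eq_zero.1 h11).resolve_left hf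
    exact hg' this

/-! ### Case B of the rank-one lemma: `μ ∝ 𝟙*` admits no isotropic plane -/

/-- For `x` isotropic for all `T(·,·,c)`, `c ∈ ker μ`, with all `μ(e_p)` equal and non-zero, the
products `(x_p − x_q)(x_m + x_n)` vanish. [folklore] -/
theorem products_eq_zero_of_isotropic_const (μ : (Fin 4 → K) →ₗ[K] K) (s : K)
    (hm : ∀ p : Fin 4, μ (Pi.single p 1) = s) (x : Fin 4 → K)
    (hx : ∀ c : Fin 4 → K, μ c = 0 →
      (Matrix.of ![(fun _ => (1 : K)), x, x, c]).permanent = 0) :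
    (x 0 - x 1) * (x 2 + x 3) = 0 ∧ (x 2 - x 3) * (x 0 + x 1) = 0 ∧
      (x 0 - x 2) * (x 1 + x 3) = 0 := by
  have hμ : ∀ c : Fin 4 → K, μ c = s * (c 0 + c 1 + c 2 + c 3) := fun c => by
    rw [apply_eq_dotProduct, dotProduct, Fin.sum_univ_four, hm, hm, hm, hm]; ring
  have hker : ∀ c : Fin 4 → K, c 0 + c 1 + c 2 + c 3 = 0 → μ c = 0 := fun c hc => by
    rw [hμ, hc, mul_zero]
  have e01 := hx (Pi.single 0 1 - Pi.single 1 1) (hker _ (by simp))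
  have e23 := hx (Pi.single 2 1 - Pi.single 3 1) (hker _ (by simp))
  have e02 := hx (Pi.single 0 1 - Pi.single 2 1) (hker _ (by simp))
  rw [per_last_eq_dotProduct, dotProduct_sub, dotProduct_single, dotProduct_single, mul_one,
    mul_one] at e01 e23 e02
  simp only [per_self_single₀, per_self_single₁, per_self_single₂, per_self_single₃] at e01 e23 e02
  exact ⟨by linear_combination -e01 / 2, by linear_combination -e23 / 2,
    by linear_combination -e02 / 2⟩

omit [CharZero K] in
/-- Two vectors on a common line through `r`, the first non-zero, are dependent. [folklore] -/
theorem exists_smul_of_on_line (w w' r : Fin 4 → K) (α β : K) (hwr : w = α • r) (hw'r : w' = β • r)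
    (hw : w ≠ 0) : ∃ t : K, w' = t • w := by
  have hα : α ≠ 0 := by rintro rfl; exact hw (by rw [hwr, zero_smul])
  exact ⟨β / α, by rw [hw'r, hwr, smul_smul, div_mul_cancel₀ _ hα]⟩

omit [CharZero K] in
/-- Coordinatewise description of `w = α • (r₀, r₁, r₂, r₃)`. [folklore] -/
theorem eq_smul_vec (w : Fin 4 → K) (α r₀ r₁ r₂ r₃ : K) (h0 : w 0 = α * r₀) (h1 : w 1 = α * r₁)
    (h2 : w 2 = α * r₂) (h3 : w 3 = α * r₃) : w = α • ![r₀, r₁, r₂, r₃] := by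
  funext p; fin_cases p <;> simp [h0, h1, h2, h3]

/-- **Case B**: if all `μ(e_p)` are equal, two linearly independent vectors cannot span a plane
isotropic for all `T(·,·,c)`, `c ∈ ker μ`. [folklore] -/
theorem false_of_isotropic_pair_const (μ : (Fin 4 → K) →ₗ[K] K) (s : K)
    (hm : ∀ p : Fin 4, μ (Pi.single p 1) = s) (w w' : Fin 4 → K) (hw : w ≠ 0)
    (hind : ∀ t : K, w' ≠ t • w)
    (hiso : ∀ (a b : K) (c : Fin 4 → K), μ c = 0 →
      (Matrix.of ![(fun _ => (1 : K)), a • w + b • w', a • w + b • w', c]).permanent = 0) :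
    False := by
  have hP := fun a b => products_eq_zero_of_isotropic_const μ s hm (a • w + b • w')
    (hiso a b)
  -- the six linear forms
  let L : (Fin 4 → K) → (Fin 4 → K) →ₗ[K] K := fun r =>
    { toFun := fun x => r ⬝ᵥ x, map_add' := fun x y => dotProduct_add _ _ _,
      map_smul' := fun t x => by simp [dotProduct_smul] }
  have hL : ∀ r x : Fin 4 → K, L r x = r 0 * x 0 + r 1 * x 1 + r 2 * x 2 + r 3 * x 3 :=
    fun r x => by simp [L, dotProduct, Fin.sum_univ_four]
  have hd01 := vanish_or_vanish_of_mul_eq_zero (L ![1, -1, 0, 0]) (L ![0, 0, 1, 1]) w w'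
    (fun a b => by
      rw [hL, hL]; simp only [Matrix.cons_val_zero, Matrix.cons_val_one, Matrix.cons_val]
      linear_combination (hP a b).1)
  have hd23 := vanish_or_vanish_of_mul_eq_zero (L ![0, 0, 1, -1]) (L ![1, 1, 0, 0]) w w'
    (fun a b => by
      rw [hL, hL]; simp only [Matrix.cons_val_zero, Matrix.cons_val_one, Matrix.cons_val]
      linear_combination (hP a b).2.1)
  have hd02 := vanish_or_vanish_of_mul_eq_zero (L ![1, 0, -1, 0]) (L ![0, 1, 0, 1]) w w'
    (fun a b => by
      rw [hL, hL]; simp only [Matrix.cons_val_zero, Matrix.cons_val_one, Matrix.cons_val]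
      linear_combination (hP a b).2.2)
  simp only [hL, Matrix.cons_val_zero, Matrix.cons_val_one, Matrix.cons_val, one_mul, zero_mul,
    add_zero, zero_add, neg_mul] at hd01 hd23 hd02
  -- eight cases; in each `w, w'` lie on one explicit line
  have fin : ∀ (r : Fin 4 → K) (α β : K), w = α • r → w' = β • r → False := fun r α β h h' => by
    obtain ⟨t, ht⟩ := exists_smul_of_on_line w w' r α β h h' hw
    exact hind t ht
  rcases hd01 with ⟨a0, a1⟩ | ⟨a0, a1⟩ <;> rcases hd23 with ⟨b0, b1⟩ | ⟨b0, b1⟩ <;>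
    rcases hd02 with ⟨c0, c1⟩ | ⟨c0, c1⟩
  · exact fin ![1, 1, 1, 1] (w 0) (w' 0) (eq_smul_vec w (w 0) 1 1 1 1 (by linear_combination) (by linear_combination -a0) (by linear_combination -c0) (by linear_combination -b0 - c0))
      (eq_smul_vec w' (w' 0) 1 1 1 1 (by linear_combination) (by linear_combination -a1) (by linear_combination -c1) (by linear_combination -b1 - c1))
  · exact fin ![1, 1, -1, -1] (w 0) (w' 0) (eq_smul_vec w (w 0) 1 1 (-1) (-1) (by linear_combination) (by linear_combination -a0) (by linear_combination a0 + b0 + c0) (by linear_combination c0 + a0))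
      (eq_smul_vec w' (w' 0) 1 1 (-1) (-1) (by linear_combination) (by linear_combination -a1) (by linear_combination a1 + b1 + c1) (by linear_combination c1 + a1))
  · exact fin ![0, 0, 0, 1] (w 3) (w' 3) (eq_smul_vec w (w 3) 0 0 0 1 (by linear_combination (a0 + b0) / 2) (by linear_combination (b0 - a0) / 2) (by linear_combination (a0 + b0) / 2 - c0) (by linear_combination))
      (eq_smul_vec w' (w' 3) 0 0 0 1 (by linear_combination (a1 + b1) / 2) (by linear_combination (b1 - a1) / 2) (by linear_combination (a1 + b1) / 2 - c1) (by linear_combination))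
  · exact fin ![0, 0, 1, 0] (w 2) (w' 2) (eq_smul_vec w (w 2) 0 0 1 0 (by linear_combination (a0 + b0) / 2) (by linear_combination (b0 - a0) / 2) (by linear_combination) (by linear_combination c0 - (b0 - a0) / 2))
      (eq_smul_vec w' (w' 2) 0 0 1 0 (by linear_combination (a1 + b1) / 2) (by linear_combination (b1 - a1) / 2) (by linear_combination) (by linear_combination c1 - (b1 - a1) / 2))
  · exact fin ![0, 1, 0, 0] (w 1) (w' 1) (eq_smul_vec w (w 1) 0 1 0 0 (by linear_combination c0 + (a0 + b0) / 2) (by linear_combination) (by linear_combination (a0 + b0) / 2) (by linear_combination (a0 - b0) / 2))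
      (eq_smul_vec w' (w' 1) 0 1 0 0 (by linear_combination c1 + (a1 + b1) / 2) (by linear_combination) (by linear_combination (a1 + b1) / 2) (by linear_combination (a1 - b1) / 2))
  · exact fin ![1, 0, 0, 0] (w 0) (w' 0) (eq_smul_vec w (w 0) 1 0 0 0 (by linear_combination) (by linear_combination c0 - (a0 - b0) / 2) (by linear_combination (a0 + b0) / 2) (by linear_combination (a0 - b0) / 2))
      (eq_smul_vec w' (w' 0) 1 0 0 0 (by linear_combination) (by linear_combination c1 - (a1 - b1) / 2) (by linear_combination (a1 + b1) / 2) (by linear_combination (a1 - b1) / 2))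
  · exact fin ![1, -1, 1, -1] (w 0) (w' 0) (eq_smul_vec w (w 0) 1 (-1) 1 (-1) (by linear_combination) (by linear_combination b0) (by linear_combination -c0) (by linear_combination a0 + c0))
      (eq_smul_vec w' (w' 0) 1 (-1) 1 (-1) (by linear_combination) (by linear_combination b1) (by linear_combination -c1) (by linear_combination a1 + c1))
  · exact fin ![1, -1, -1, 1] (w 0) (w' 0) (eq_smul_vec w (w 0) 1 (-1) (-1) 1 (by linear_combination) (by linear_combination b0) (by linear_combination a0 - c0 + b0) (by linear_combination c0 - b0))
      (eq_smul_vec w' (w' 0) 1 (-1) (-1) 1 (by linear_combination) (by linear_combination b1) (by linear_combination a1 - c1 + b1) (by linear_combination c1 - b1))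

/-! ### The per₂ kill -/

omit [CharZero K] in
/-- `T(y, e_k, e_j) = e₁(y) − y_k − y_j` for `k ≠ j`, and `0` for `k = j`. [folklore] -/
theorem per_single_single (y : Fin 4 → K) (k j : Fin 4) :
    (Matrix.of ![(fun _ => (1 : K)), y, Pi.single k 1, Pi.single j 1]).permanent =
      if k = j then 0 else (y 0 + y 1 + y 2 + y 3) - y k - y j := by
  fin_cases k <;> fin_cases j <;> simp [permanent_of_rows] <;> ring

omit [CharZero K] in
/-- Expansion of `A a` along the coordinate vectors. [folklore] -/
theorem apply_eq_sum_single (A : (Fin 4 → K) →ₗ[K] (Fin 4 → K)) (a : Fin 4 → K) :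
    A a = a 0 • A (Pi.single 0 1) + a 1 • A (Pi.single 1 1) + a 2 • A (Pi.single 2 1) +
      a 3 • A (Pi.single 3 1) := by
  have ha : a = a 0 • (Pi.single 0 (1 : K) : Fin 4 → K) + a 1 • Pi.single 1 1 +
      a 2 • Pi.single 2 1 + a 3 • Pi.single 3 1 := by
    funext j; fin_cases j <;> simp
  conv_lhs => rw [ha]
  simp only [map_add, map_smul]

/-- **The per₂ kill**: a square-zero linear map of `K⁴`, self-adjoint for all `T(·,·,c)`,
`c ∈ ker μ`, cannot have both `e₀` and `e₁` in its image.  (Isotropy of the image forces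
`ker μ = {c₂ + c₃ = 0}`, the per₂ plane; there self-adjointness forces `A e₂ = A e₃ ∈ K(e₀ − e₁)`,
so `e₀ ∉ im A`.) [folklore] -/
theorem false_of_single₀_single₁_mem_range (μ : (Fin 4 → K) →ₗ[K] K)
    (A : (Fin 4 → K) →ₗ[K] (Fin 4 → K))
    (hsa : ∀ a b c : Fin 4 → K, μ c = 0 →
      (Matrix.of ![(fun _ => (1 : K)), A a, b, c]).permanent =
        (Matrix.of ![(fun _ => (1 : K)), a, A b, c]).permanent)
    (hsq : ∀ a, A (A a) = 0) (a₀ a₁ : Fin 4 → K) (h0 : A a₀ = Pi.single 0 1)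
    (h1 : A a₁ = Pi.single 1 1) : False := by
  -- isotropy of the image: `c₂ + c₃ = 0` on `ker μ`
  have hiso : ∀ c : Fin 4 → K, μ c = 0 → c 2 + c 3 = 0 := fun c hc => by
    have h := hsa a₀ (A a₁) c hc
    rw [hsq, h0, h1] at h
    have h0' : (Matrix.of ![(fun _ => (1 : K)), a₀, (0 : Fin 4 → K), c]).permanent = 0 := by
      simp only [permanent_of_rows, Pi.zero_apply]; ring
    rw [h0', per_last_eq_dotProduct] at h
    simp only [dotProduct, Fin.sum_univ_four, per_single_single] at h
    simpa using h
  obtain ⟨t, ht⟩ := exists_coeff_of_vanish μ ![0, 0, 1, 1] fun c hc => by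
    simp [dotProduct, Fin.sum_univ_four, hiso c hc]
  have ht0 := ht 0; have ht1 := ht 1; have ht2 := ht 2; have ht3 := ht 3
  simp only [Matrix.cons_val_zero, Matrix.cons_val_one, Matrix.cons_val] at ht0 ht1 ht2 ht3
  have htne : t ≠ 0 := by rintro rfl; simp at ht2
  have hm0 : μ (Pi.single 0 1) = 0 := by
    rcases mul_eq_zero.1 ht0.symm with h | h
    · exact absurd h htne
    · exact h
  have hm1 : μ (Pi.single 1 1) = 0 := by
    rcases mul_eq_zero.1 ht1.symm with h | h
    · exact absurd h htne
    · exact h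
  have hm23 : μ (Pi.single 2 1) = μ (Pi.single 3 1) := by
    have := mul_left_cancel₀ htne (ht2.symm.trans ht3); exact this
  have hker : ∀ c : Fin 4 → K, c 2 + c 3 = 0 → μ c = 0 := fun c hc => by
    rw [apply_eq_dotProduct, dotProduct, Fin.sum_univ_four, hm0, hm1, hm23]
    linear_combination μ (Pi.single 3 1) * hc
  have hL23 : μ (Pi.single 2 1 - Pi.single 3 1) = 0 := hker _ (by simp)
  -- kernel vectors
  have hA0 : A (Pi.single 0 1) = 0 := by rw [← h0, hsq]
  have hA1 : A (Pi.single 1 1) = 0 := by rw [← h1, hsq]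
  set y := A (Pi.single 2 1) with hy
  set y' := A (Pi.single 3 1) with hy'
  -- `T(y, e₀, c) = 0`, `T(y', e₀, c) = 0` on `ker μ`
  have hy0 : ∀ c, μ c = 0 → (Matrix.of ![(fun _ => (1 : K)), y, Pi.single 0 1, c]).permanent = 0 :=
    fun c hc => by
    have h := hsa (Pi.single 2 1) (Pi.single 0 1) c hc
    rw [hA0] at h
    have h0' : (Matrix.of ![(fun _ => (1 : K)), (Pi.single 2 1 : Fin 4 → K), (0 : Fin 4 → K),
        c]).permanent = 0 := by
      simp only [permanent_of_rows, Pi.zero_apply]; ring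
    rw [h0'] at h; exact h
  have hy'0 : ∀ c, μ c = 0 →
      (Matrix.of ![(fun _ => (1 : K)), y', Pi.single 0 1, c]).permanent = 0 := fun c hc => by
    have h := hsa (Pi.single 3 1) (Pi.single 0 1) c hc
    rw [hA0] at h
    have h0' : (Matrix.of ![(fun _ => (1 : K)), (Pi.single 3 1 : Fin 4 → K), (0 : Fin 4 → K),
        c]).permanent = 0 := by
      simp only [permanent_of_rows, Pi.zero_apply]; ring
    rw [h0'] at h; exact h
  have e1 := hy0 _ hm1
  have e2 := hy0 _ hL23
  have e1' := hy'0 _ hm1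
  have e2' := hy'0 _ hL23
  rw [per_last_eq_dotProduct] at e1 e2 e1' e2'
  simp only [dotProduct, Fin.sum_univ_four, per_single_single, Pi.sub_apply] at e1 e2 e1' e2'
  simp at e1 e2 e1' e2'
  -- self-adjointness at `(e₂, e₃)`
  have hs23 : ∀ c, μ c = 0 →
      (Matrix.of ![(fun _ => (1 : K)), y, Pi.single 3 1, c]).permanent =
        (Matrix.of ![(fun _ => (1 : K)), y', Pi.single 2 1, c]).permanent := fun c hc => by
    rw [per_swap₁₂ y']; exact hsa _ _ c hc
  have f0 := hs23 _ hm0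
  have f1 := hs23 _ hm1
  have f2 := hs23 _ hL23
  rw [per_last_eq_dotProduct, per_last_eq_dotProduct] at f0 f1 f2
  simp only [dotProduct, Fin.sum_univ_four, per_single_single, Pi.sub_apply] at f0 f1 f2
  simp at f0 f1 f2
  -- expand `e₀ = A a₀`
  have hexp := apply_eq_sum_single A a₀
  rw [h0, hA0, hA1, smul_zero, smul_zero, zero_add, zero_add] at hexp
  have c0 := congr_fun hexp 0
  have c1 := congr_fun hexp 1
  simp [← hy, ← hy'] at c0 c1
  -- combine: y₂ = 0 = y'₃, y₀ + y₁ = 0 = y'₀ + y'₁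
  have hy2 : y 2 = 0 := by linear_combination (e1 - e2) / 2
  have hy3' : y' 3 = 0 := by linear_combination (e1' + e2') / 2
  have hS : y 0 + y 1 = 0 := by linear_combination (f0 + f1 + f2) / 2 - hy2 + hy3'
  have hS' : y' 0 + y' 1 = 0 := by linear_combination f2 - hS
  have h10 : (1 : K) = 0 := by linear_combination c0 + c1 + a₀ 2 * hS + a₀ 3 * hS'
  exact one_ne_zero h10

end Summit.ValiantsHypothesis.ValiantsHypothesis.Theorems.SymPencilPerFourHyperplanePencilRankOneA
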